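import Literature.NumberTheory.Rogawski1990.LocalStableClassesNonsplitScalarFrameCompactCentralizer
import Literature.NumberTheory.Rogawski1990.LocalTransferLinear
import Literature.NumberTheory.Rogawski1990.FinExplicitTransferFactorScalarPartner
import Literature.LinearAlgebra.Matrix.RegularSemisimpleConjClassClosed
import HarnessLib

/-!
# SATURATION AT THE SECOND CLASS: near `ε_H` the matched `Q′`-side classes have their framed representative NEAR `ε′` INSIDE the compact dock `Z(ε′)`
# (Rogawski 1990, §8.2 Prop. 8.2.1 (a)(d): `G_{ε′} ≅ U(2)ᵃⁿ × E¹` is compact; an anisotropic unitary group has no unipotent elements)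

Topic `NumberTheory/Rogawski1990`; namespace `Literature.NumberTheory.Rogawski1990`.  **THEOREMS ONLY** (no definition, no named fact, no instance, no notation,
no `sorry`).  Cell `pub/hodgecm-mathlib`, road «N6nsGerm» (crux H413), binder **`hD′` of ★ `exists_nhds_finsum_side_eq_stableOrbitalIntegralRel_of_compact_dock`**
(its saturation clause «`∃ m ∈ B′`»); seat A-p17 (g21), census `CENSUS-hDprime-SecondClassDescent` §1 (e).  HONEST LABEL: HC_CM is proved only modulo the printed
citations until rung 0 closes; this file is unconditional local algebra ∕ topology.

THE MATHEMATICS.  `v` non-split, `ε_H = (a·1₂, u)`, `u ≠ a`; `P′` a frame of `H′_v` with `ᵗ(σP′) H′_v P′ = G₁′ ⊕ᶠ G₂′`, `G₁′` ANISOTROPIC, and `ε′ P′ = P′ (a·1₂ ⊕ᶠ u)` the second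
class.  A `Q′`-framed match `g` of `γ_H` (`g P′ = P′ (B ⊕ᶠ γ_{H,2})`, `g ∼ ι_v(γ_H)`) lies in `Z(ε′)`, and the continuous map `m ↦ (χ_m, (P′⁻¹ m P′)₂₂)` on the COMPACT
group `Z(ε′)` (★ `compactSpace_centralizer_of_frame_of_anisotropic`) takes at `g` the value `(χ_{ι γ_H}, γ_{H,2})`, which tends to its value at `ε′` as `γ_H → ε_H`.  Its
fibre over that value is `{ε′}`: an element of `Z(ε′)` is `P′(B ⊕ᶠ t)P′⁻¹` with `B ∈ U(G₁′)`; `χ_B = (X − a)²` forces `(B − a)² = 0` (Cayley–Hamilton), and §1: a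
unitary `B` of an ANISOTROPIC form with `(B − a)² = 0`, `σ(a) a = 1`, IS `a·1` (for `z = (B − a)y`: `Bz = az`, so `h(z, Bw) = a h(z, w)`, `h(z, (B − a)w) = 0`, `h(z, z) = 0`).
By compactness the fibre statement upgrades to neighbourhoods (the image of the complement of an open `B′ ∋ ε′` is compact and misses the value).

* §1 **`eq_smul_one_of_unitary_of_mul_self_eq_zero`** (ring-generic: no unipotents times a norm-one scalar in an anisotropic unitary group).
* §2 **`exists_nhds_forall_frameRep_mem_centralizer_nhds`** (the saturation clause at the CM carriers).

## References
* [Rogawski1990] J. D. Rogawski, *Automorphic Representations of Unitary Groups in Three Variables*, Ann. of Math. Stud. 123 (1990), §3.8 Prop. 3.8.1 (a)(d) pp. 27–30;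
  §8.2 Prop. 8.2.1 pp. 112–122.
* [PlatonovRapinchuk1994] V. Platonov, A. Rapinchuk, *Algebraic Groups and Number Theory* (1994), §3.1 Thm. 3.1 (anisotropic ⇔ compact; no unipotents).
* [HarishChandra1970] Harish-Chandra (van Dijk), *Harmonic Analysis on Reductive p-adic Groups*, LNM 162 (1970), Part I §3 Lemma 19.
-/

set_option autoImplicit false

noncomputable section

open NumberField IsDedekindDomain Matrix Topology Polynomial Set Filter
open scoped MatrixGroups

namespace Literature.NumberTheory.Rogawski1990

open Literature.NumberTheory.Automorphic Literature.NumberTheory.Automorphic.UnitaryGroup Literature.NumberTheory.GaloisRepresentations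
open Literature.AlgebraicGeometry.ShimuraVarieties (unitaryGroup)
open Literature.LinearAlgebra.Matrix (continuous_charpoly_coeff)

/-! ## §1 Ring-generic: an anisotropic unitary group has no element `B ≠ a·1` with `(B − a)² = 0` -/

section Generic

variable {S : Type*} [CommRing S] (σ : S →+* S) {n : Type*} [Fintype n] [DecidableEq n]

omit [DecidableEq n] in
/-- `h(x, c • v) = c · h(x, v)`. [folklore] -/
private theorem hermForm_smul_right₁₇ (G : Matrix n n S) (x v : n → S) (c : S) : hermForm σ G x (c • v) = c * hermForm σ G x v := by
  simp only [hermForm, Matrix.mulVec_smul, dotProduct_smul, smul_eq_mul]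

/-- **NO UNIPOTENTS (times a norm-one scalar) IN AN ANISOTROPIC UNITARY GROUP.**  `G` a Gram matrix with `h_G(x, x) = 0 ⇒ x = 0`, `B` unitary for `G`
(`ᵗ(σB) G B = G`), `σ(a) a = 1` and `(B − a·1)² = 0` ⇒ `B = a·1`.  (For `z := (B − a)y`: `Bz = az`, unitarity gives `h(z, Bw) = a·h(z, w)`, so `h(z, (B − a)y) = h(z, z) = 0`.)
[cite: PlatonovRapinchuk1994, §3.1 Thm. 3.1] [cite: Rogawski1990, §3.8 Prop. 3.8.1 (a) p. 27] -/
theorem eq_smul_one_of_unitary_of_mul_self_eq_zero {G : Matrix n n S} (hanis : ∀ x : n → S, hermForm σ G x x = 0 → x = 0)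
    {B : Matrix n n S} (hB : (B.map σ)ᵀ * G * B = G) {a : S} (ha : σ a * a = 1) (hN : (B - a • 1) * (B - a • 1) = 0) :
    B = a • (1 : Matrix n n S) := by
  have hunit := (transpose_map_mul_mul_eq_iff_hermForm σ G B).1 hB
  -- every `z = (B − a)y` vanishes
  have hz : ∀ y : n → S, (B - a • 1) *ᵥ y = 0 := by
    intro y
    set z := (B - a • 1) *ᵥ y with hzdef
    have hNz : (B - a • 1) *ᵥ z = 0 := by rw [hzdef, Matrix.mulVec_mulVec, hN, Matrix.zero_mulVec]
    have hBz : B *ᵥ z = a • z := by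
      have h1 : (B - a • 1) *ᵥ z = B *ᵥ z - a • z := by rw [Matrix.sub_mulVec, Matrix.smul_mulVec, Matrix.one_mulVec]
      rw [h1, sub_eq_zero] at hNz
      exact hNz
    -- `h(z, B w) = a · h(z, w)`
    have hzB : ∀ w : n → S, hermForm σ G z (B *ᵥ w) = a * hermForm σ G z w := by
      intro w
      have h1 := hunit z w
      rw [hBz, hermForm_smul_left_eq] at h1
      calc hermForm σ G z (B *ᵥ w) = (a * σ a) * hermForm σ G z (B *ᵥ w) := by rw [mul_comm a, ha, one_mul]
        _ = a * hermForm σ G z w := by rw [mul_assoc, h1]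
    have hzz : hermForm σ G z z = 0 := by
      have h1 : hermForm σ G z ((B - a • 1) *ᵥ y) = 0 := by
        rw [Matrix.sub_mulVec, Matrix.smul_mulVec, Matrix.one_mulVec, hermForm_sub_right, hzB, hermForm_smul_right₁₇, sub_self]
      rwa [← hzdef] at h1
    exact hanis z hzz
  rw [← sub_eq_zero]
  ext i j
  have h := congrFun (hz (Pi.single j 1)) i
  rwa [Matrix.mulVec_single_one, Pi.zero_apply] at h

end Generic

/-! ## §2 The saturation clause at the CM carriers -/

section CM

variable (L : Type) [Field L] [NumberField L] [IsCMField L] (v : HeightOneSpectrum (𝓞 ↥(maximalRealSubfield L)))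
  (H' : Matrix (Fin 3) (Fin 3) L)

/-- `χ` of a `1 × 1` matrix. [folklore] -/
private theorem charpoly_fin_one₁₇ {S : Type*} [CommRing S] (A : Matrix (Fin 1) (Fin 1) S) : A.charpoly = X - C (A 0 0) := by
  rw [Matrix.charpoly, Matrix.det_fin_one, Matrix.charmatrix_apply_eq]

/-- `χ_{B ⊕ᶠ T} = χ_B · χ_T`. [folklore] -/
private theorem charpoly_finSum₁₇ {S : Type*} [CommRing S] {N₁ N₂ : ℕ} (B : Matrix (Fin N₁) (Fin N₁) S) (T : Matrix (Fin N₂) (Fin N₂) S) :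
    (finSum N₁ N₂ B T).charpoly = B.charpoly * T.charpoly := by
  rw [finSum, Matrix.charpoly_reindex, Matrix.charpoly_fromBlocks_zero₁₂]

/-- `χ_{a·1₂} = (X − a)²`. [folklore] -/
private theorem charpoly_smul_one_two₁₇ {S : Type*} [CommRing S] (a : S) : (a • (1 : Matrix (Fin 2) (Fin 2) S)).charpoly = (X - C a) ^ 2 := by
  rw [smul_one_eq_diagonal, Matrix.charpoly_diagonal, Finset.prod_const, Finset.card_univ, Fintype.card_fin]

/-- A `1 × 1` matrix is the scalar of its entry. [folklore] -/
private theorem fin_one_eq_smul_one₁₇ {S : Type*} [CommRing S] (T : Matrix (Fin 1) (Fin 1) S) : T = T 0 0 • (1 : Matrix (Fin 1) (Fin 1) S) := by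
  ext i j
  fin_cases i; fin_cases j
  simp

/-- The `(inr i, inr j)` entry of `A ⊕ᶠ B` is `B i j`. [folklore] -/
private theorem finSum_apply_inr₁₇ {S : Type*} [CommRing S] {N₁ N₂ : ℕ} (A : Matrix (Fin N₁) (Fin N₁) S) (B : Matrix (Fin N₂) (Fin N₂) S) (i j : Fin N₂) :
    finSum N₁ N₂ A B (finSumFinEquiv (Sum.inr i)) (finSumFinEquiv (Sum.inr j)) = B i j := by
  rw [finSum, reindex_apply, submatrix_apply, Equiv.symm_apply_apply, Equiv.symm_apply_apply, fromBlocks_apply₂₂]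

/-- `(A ⊕ᶠ B)(C ⊕ᶠ D) = AC ⊕ᶠ BD`. [folklore] -/
private theorem finSum_mul_finSum₁₇ {S : Type*} [CommRing S] {N₁ N₂ : ℕ} (A C : Matrix (Fin N₁) (Fin N₁) S) (B D : Matrix (Fin N₂) (Fin N₂) S) :
    finSum N₁ N₂ A B * finSum N₁ N₂ C D = finSum N₁ N₂ (A * C) (B * D) := by
  simp only [finSum, Matrix.reindex_apply, Matrix.submatrix_mul_equiv, Matrix.fromBlocks_multiply, Matrix.mul_zero, Matrix.zero_mul,
    add_zero, zero_add]

/-- Blocks of a block-unitarity: `ᵗσ(B ⊕ᶠ T)·(G₁ ⊕ᶠ G₂)·(B ⊕ᶠ T) = G₁ ⊕ᶠ G₂` ⇒ `ᵗ(σB) G₁ B = G₁`. [folklore] -/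
private theorem block_unitary_fst₁₇ {S : Type*} [CommRing S] (σ : S →+* S) {N₁ N₂ : ℕ} {G₁ B : Matrix (Fin N₁) (Fin N₁) S} {G₂ T : Matrix (Fin N₂) (Fin N₂) S}
    (h : ((finSum N₁ N₂ B T).map σ)ᵀ * finSum N₁ N₂ G₁ G₂ * finSum N₁ N₂ B T = finSum N₁ N₂ G₁ G₂) : (B.map σ)ᵀ * G₁ * B = G₁ := by
  rw [transpose_finSum_map, finSum_mul_finSum₁₇, finSum_mul_finSum₁₇] at h
  have h1 := (Matrix.reindex finSumFinEquiv finSumFinEquiv).injective h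
  rw [Matrix.fromBlocks_inj] at h1
  exact h1.1

set_option maxHeartbeats 400000 in
/-- **SATURATION AT THE SECOND CLASS.**  `v` non-split, `ε_H = (a·1₂, u)` with `u ≠ a`, `P′` a frame of `H′_v` with Gram blocks `G₁′ ⊕ᶠ G₂′`, `G₁′` anisotropic,
`ε′ P′ = P′(a·1₂ ⊕ᶠ γ_{ε_H,2})`.  For every neighbourhood `B′` of `ε′` in `Z(ε′)` there is a neighbourhood `V ∋ ε_H` such that every `Q′`-FRAMED match `g` of a `γ_H ∈ V`
(`g P′ = P′(B ⊕ᶠ γ_{H,2})`, `(γ_H, g)` a local norm pair) lies in `Z(ε′)` AND in `B′`.  (Compactness of `Z(ε′)` ★ `compactSpace_centralizer_of_frame_of_anisotropic`; the fibre of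
`m ↦ (χ_m, (P′⁻¹mP′)₂₂)` over its value at `ε′` is `{ε′}` by §1.) [cite: Rogawski1990, §8.2 Prop. 8.2.1 (a)(d) pp. 112–122; §3.8 Prop. 3.8.1 (a) p. 27]
[cite: HarishChandra1970, Part I §3 Lemma 19] -/
theorem exists_nhds_forall_frameRep_mem_centralizer_nhds (w : UnitaryGroup.PlacesOver L v) (hw : IsCMField.complexConj L • w.1 = w.1)
    (hHd : IsUnit ((UnitaryGroup.adelicForm L 3 H').map (UnitaryGroup.adeleToLocal L v)).det)
    (εH : (UnitaryGroup.cmDatum L 2 (Matrix.of fun i j : Fin 2 => if i.val + j.val + 1 = 2 then (1 : L) else 0)).Local v ×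
      (UnitaryGroup.cmDatum L 1 (Matrix.of fun i j : Fin 1 => if i.val + j.val + 1 = 1 then (1 : L) else 0)).Local v) (a : UnitaryGroup.LocalRing L v)
    (ha : (εH.1.val.val : Matrix (Fin 2) (Fin 2) (UnitaryGroup.LocalRing L v)) = a • (1 : Matrix (Fin 2) (Fin 2) (UnitaryGroup.LocalRing L v)))
    (hu : (εH.2.val.val : Matrix (Fin 1) (Fin 1) (UnitaryGroup.LocalRing L v)) 0 0 ≠ a)
    {P' : GL (Fin 3) (UnitaryGroup.LocalRing L v)} {G₁' : Matrix (Fin 2) (Fin 2) (UnitaryGroup.LocalRing L v)} {G₂' : Matrix (Fin 1) (Fin 1) (UnitaryGroup.LocalRing L v)}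
    (hP' : twistGram (UnitaryGroup.conjLocal L (IsCMField.complexConj L) v) ((UnitaryGroup.adelicForm L 3 H').map (UnitaryGroup.adeleToLocal L v)) P'.val =
      finSum 2 1 G₁' G₂')
    (hanis' : ∀ x : Fin 2 → UnitaryGroup.LocalRing L v, hermForm (UnitaryGroup.conjLocal L (IsCMField.complexConj L) v) G₁' x x = 0 → x = 0)
    (ε' : (UnitaryGroup.cmDatum L 3 H').Local v)
    (hε' : (ε'.val.val : Matrix (Fin 3) (Fin 3) (UnitaryGroup.LocalRing L v)) * P'.val =
      P'.val * finSum 2 1 (a • (1 : Matrix (Fin 2) (Fin 2) (UnitaryGroup.LocalRing L v))) (εH.2.val.val : Matrix (Fin 1) (Fin 1) (UnitaryGroup.LocalRing L v))) :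
    ∀ B' ∈ 𝓝 (⟨ε', Subgroup.mem_centralizer_singleton_iff.2 rfl⟩ : ↥(Subgroup.centralizer ({ε'} : Set ((UnitaryGroup.cmDatum L 3 H').Local v)))),
      ∃ V ∈ 𝓝 εH, ∀ γH ∈ V, ∀ g : (UnitaryGroup.cmDatum L 3 H').Local v,
        (∃ B : Matrix (Fin 2) (Fin 2) (UnitaryGroup.LocalRing L v), (g.val.val : Matrix (Fin 3) (Fin 3) (UnitaryGroup.LocalRing L v)) * P'.val =
          P'.val * finSum 2 1 B (γH.2.val.val : Matrix (Fin 1) (Fin 1) (UnitaryGroup.LocalRing L v))) →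
        IsLocalNormPair L H' v γH g →
          ∃ hg : g ∈ Subgroup.centralizer ({ε'} : Set ((UnitaryGroup.cmDatum L 3 H').Local v)),
            (⟨g, hg⟩ : ↥(Subgroup.centralizer ({ε'} : Set ((UnitaryGroup.cmDatum L 3 H').Local v)))) ∈ B' := by
  classical
  haveI : Algebra.IsQuadraticExtension ↥(maximalRealSubfield L) L := IsCMField.isQuadraticExtension L
  have hv : Subsingleton (UnitaryGroup.PlacesOver L v) :=
    UnitaryGroup.PlacesOver.subsingleton_of_smul_eq (IsCMField.complexConj L) (IsCMField.complexConj_ne_one L) w hw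
  set σ := UnitaryGroup.conjLocal L (IsCMField.complexConj L) v with hσdef
  set Hv := (UnitaryGroup.adelicForm L 3 H').map (UnitaryGroup.adeleToLocal L v) with hHvdef
  set u : UnitaryGroup.LocalRing L v := (εH.2.val.val : Matrix (Fin 1) (Fin 1) (UnitaryGroup.LocalRing L v)) 0 0 with hudef
  set Z := Subgroup.centralizer ({ε'} : Set ((UnitaryGroup.cmDatum L 3 H').Local v)) with hZdef
  have hU1 : (εH.2.val.val : Matrix (Fin 1) (Fin 1) (UnitaryGroup.LocalRing L v)) = u • (1 : Matrix (Fin 1) (Fin 1) _) := fin_one_eq_smul_one₁₇ _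
  set D := finSum 2 1 (a • (1 : Matrix (Fin 2) (Fin 2) (UnitaryGroup.LocalRing L v))) (u • (1 : Matrix (Fin 1) (Fin 1) (UnitaryGroup.LocalRing L v)))
    with hD
  have hε'D : (ε'.val.val : Matrix (Fin 3) (Fin 3) (UnitaryGroup.LocalRing L v)) * P'.val = P'.val * D := by rw [hD, ← hU1]; exact hε'
  have hau : IsUnit (a - u) := isUnit_localRing_of_ne_zero_of_subsingleton L v hv (sub_ne_zero.2 (Ne.symm hu))
  have hσa : σ a * a = 1 := conjLocal_mul_self_of_fst_eq_smul_one L v εH ha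
  -- `P′`-conjugation bookkeeping
  have hPinv : (P'⁻¹).val * P'.val = 1 := by rw [← Units.val_mul, inv_mul_cancel, Units.val_one]
  have hPinv' : P'.val * (P'⁻¹).val = 1 := by rw [← Units.val_mul, mul_inv_cancel, Units.val_one]
  have hconj : ∀ {M X : Matrix (Fin 3) (Fin 3) (UnitaryGroup.LocalRing L v)}, M * P'.val = P'.val * X → (P'⁻¹).val * M * P'.val = X := by
    intro M X h
    rw [Matrix.mul_assoc, h, ← Matrix.mul_assoc, hPinv, Matrix.one_mul]
  have hconj' : ∀ {M X : Matrix (Fin 3) (Fin 3) (UnitaryGroup.LocalRing L v)}, M * P'.val = P'.val * X → M = P'.val * X * (P'⁻¹).val := by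
    intro M X h
    rw [← h, Matrix.mul_assoc, hPinv', Matrix.mul_one]
  -- (1) a framed element commutes with `ε′`
  have hmemZ : ∀ (g : (UnitaryGroup.cmDatum L 3 H').Local v) (B : Matrix (Fin 2) (Fin 2) (UnitaryGroup.LocalRing L v))
      (T : Matrix (Fin 1) (Fin 1) (UnitaryGroup.LocalRing L v)),
      (g.val.val : Matrix (Fin 3) (Fin 3) (UnitaryGroup.LocalRing L v)) * P'.val = P'.val * finSum 2 1 B T → g ∈ Z := by
    intro g B T hg
    rw [hZdef, Subgroup.mem_centralizer_singleton_iff]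
    have hT1 : T = T 0 0 • (1 : Matrix (Fin 1) (Fin 1) _) := fin_one_eq_smul_one₁₇ T
    have hcomm : finSum 2 1 B T * D = D * finSum 2 1 B T := by rw [hD, hT1]; exact finSum_commute_finSum_smul_one a u B _
    have hmat : (g.val.val : Matrix (Fin 3) (Fin 3) (UnitaryGroup.LocalRing L v)) * ε'.val.val = ε'.val.val * g.val.val := by
      rw [hconj' hg, hconj' hε'D]
      calc P'.val * finSum 2 1 B T * (P'⁻¹).val * (P'.val * D * (P'⁻¹).val)
          = P'.val * finSum 2 1 B T * ((P'⁻¹).val * P'.val) * D * (P'⁻¹).val := by simp only [Matrix.mul_assoc]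
        _ = P'.val * (finSum 2 1 B T * D) * (P'⁻¹).val := by rw [hPinv, Matrix.mul_one]; simp only [Matrix.mul_assoc]
        _ = P'.val * (D * finSum 2 1 B T) * (P'⁻¹).val := by rw [hcomm]
        _ = P'.val * D * ((P'⁻¹).val * P'.val) * finSum 2 1 B T * (P'⁻¹).val := by rw [hPinv, Matrix.mul_one]; simp only [Matrix.mul_assoc]
        _ = P'.val * D * (P'⁻¹).val * (P'.val * finSum 2 1 B T * (P'⁻¹).val) := by simp only [Matrix.mul_assoc]
    exact Subtype.ext (Units.ext hmat)
  -- the `u`-slot and the characteristic polynomials of `D`, `ε′`, `ι(ε_H)`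
  set j : Fin 3 := finSumFinEquiv (m := 2) (n := 1) (Sum.inr 0) with hjdef
  have hfinj : ∀ (B : Matrix (Fin 2) (Fin 2) (UnitaryGroup.LocalRing L v)) (T : Matrix (Fin 1) (Fin 1) (UnitaryGroup.LocalRing L v)),
      finSum 2 1 B T j j = T 0 0 := fun B T => by rw [hjdef, finSum_apply_inr₁₇]
  have hDjj : D j j = u := by rw [hD, hfinj, Matrix.smul_apply, Matrix.one_apply_eq, smul_eq_mul, mul_one]
  have hχD : D.charpoly = (X - C a) ^ 2 * (X - C u) := by
    rw [hD, charpoly_finSum₁₇, charpoly_smul_one_two₁₇, charpoly_fin_one₁₇, Matrix.smul_apply, Matrix.one_apply_eq, smul_eq_mul, mul_one]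
  have hε'conj : (P'⁻¹).val * ε'.val.val * P'.val = D := hconj hε'D
  have hχε' : (ε'.val.val : Matrix (Fin 3) (Fin 3) (UnitaryGroup.LocalRing L v)).charpoly = (X - C a) ^ 2 * (X - C u) := by
    rw [← hχD, ← hε'conj, Matrix.coe_units_inv, Matrix.charpoly_units_conj']
  have hχι : ((endoEmbLocal L v εH).val.val : Matrix (Fin 3) (Fin 3) (UnitaryGroup.LocalRing L v)).charpoly =
      (X - C a) ^ 2 * (X - C u) := by
    rw [coe_endoEmbLocal, charpoly_endoGL, ha, hU1, charpoly_smul_one_two₁₇, charpoly_fin_one₁₇, Matrix.smul_apply, Matrix.one_apply_eq, smul_eq_mul,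
      mul_one]
  -- (2) the invariants map on `Z(ε′)` and its fibre over the value at `ε′`
  set εC : ↥Z := ⟨ε', Subgroup.mem_centralizer_singleton_iff.2 rfl⟩ with hεCdef
  have hval : Continuous fun m : ↥Z => (m.1.val.val : Matrix (Fin 3) (Fin 3) (UnitaryGroup.LocalRing L v)) :=
    Units.continuous_val.comp (continuous_subtype_val.comp continuous_subtype_val)
  let F : ↥Z → (ℕ → UnitaryGroup.LocalRing L v) × UnitaryGroup.LocalRing L v := fun m =>
    (fun k => ((m.1.val.val : Matrix (Fin 3) (Fin 3) (UnitaryGroup.LocalRing L v))).charpoly.coeff k,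
      ((P'⁻¹).val * (m.1.val.val : Matrix (Fin 3) (Fin 3) (UnitaryGroup.LocalRing L v)) * P'.val) j j)
  have hFc : Continuous F :=
    (continuous_pi fun k => (continuous_charpoly_coeff k).comp hval).prodMk (((continuous_const.mul hval).mul continuous_const).matrix_elem j j)
  have hFε : F εC = (fun k => ((X - C a) ^ 2 * (X - C u)).coeff k, u) := by
    show (fun k => (ε'.val.val : Matrix (Fin 3) (Fin 3) (UnitaryGroup.LocalRing L v)).charpoly.coeff k, ((P'⁻¹).val * ε'.val.val * P'.val) j j) = _
    rw [hχε', hε'conj, hDjj]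
  have hfib : ∀ m : ↥Z, F m = F εC → m = εC := by
    intro m hm
    rw [hFε] at hm
    have hχm : ((m.1.val.val : Matrix (Fin 3) (Fin 3) (UnitaryGroup.LocalRing L v))).charpoly =
        (X - C a) ^ 2 * (X - C u) := Polynomial.ext fun k => congrFun (congrArg Prod.fst hm) k
    have hmj : ((P'⁻¹).val * (m.1.val.val : Matrix (Fin 3) (Fin 3) (UnitaryGroup.LocalRing L v)) * P'.val) j j = u :=
      congrArg Prod.snd hm
    -- `M := P′⁻¹ m P′` commutes with `D`, hence is block diagonal
    set M := (P'⁻¹).val * (m.1.val.val : Matrix (Fin 3) (Fin 3) (UnitaryGroup.LocalRing L v)) * P'.val with hMdef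
    have hmε : (m.1.val.val : Matrix (Fin 3) (Fin 3) (UnitaryGroup.LocalRing L v)) * ε'.val.val =
        ε'.val.val * m.1.val.val := by
      have h1 : m.1.val * ε'.val = ε'.val * m.1.val := congrArg Subtype.val (Subgroup.mem_centralizer_singleton_iff.1 m.2)
      rw [← Units.val_mul, ← Units.val_mul, h1]
    have hMD : M * D = D * M := by
      rw [hMdef, ← hε'conj]
      calc (P'⁻¹).val * m.1.val.val * P'.val * ((P'⁻¹).val * ε'.val.val * P'.val)
          = (P'⁻¹).val * m.1.val.val * (P'.val * (P'⁻¹).val) * ε'.val.val * P'.val := by simp only [Matrix.mul_assoc]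
        _ = (P'⁻¹).val * (m.1.val.val * ε'.val.val) * P'.val := by rw [hPinv', Matrix.mul_one]; simp only [Matrix.mul_assoc]
        _ = (P'⁻¹).val * (ε'.val.val * m.1.val.val) * P'.val := by rw [hmε]
        _ = (P'⁻¹).val * ε'.val.val * (P'.val * (P'⁻¹).val) * m.1.val.val * P'.val := by rw [hPinv', Matrix.mul_one]; simp only [Matrix.mul_assoc]
        _ = (P'⁻¹).val * ε'.val.val * P'.val * ((P'⁻¹).val * m.1.val.val * P'.val) := by simp only [Matrix.mul_assoc]
    obtain ⟨B, T, hMBT⟩ := eq_finSum_of_commute (N₁ := 2) (N₂ := 1) hau M hMD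
    -- the `u`-slot: `T = u·1`
    have hT : T = u • (1 : Matrix (Fin 1) (Fin 1) _) := by
      rw [fin_one_eq_smul_one₁₇ T, ← hfinj B T, ← hMBT]
      exact congrArg (· • (1 : Matrix (Fin 1) (Fin 1) _)) hmj
    -- `χ_B = (X − a)²`
    have hχM : M.charpoly = (X - C a) ^ 2 * (X - C u) := by rw [hMdef, Matrix.coe_units_inv, Matrix.charpoly_units_conj', hχm]
    have hχB : B.charpoly = (X - C a) ^ 2 := by
      have h1 : B.charpoly * (X - C u) = (X - C a) ^ 2 * (X - C u) := by
        rw [← hχM, hMBT, charpoly_finSum₁₇, hT, charpoly_fin_one₁₇, Matrix.smul_apply, Matrix.one_apply_eq, smul_eq_mul, mul_one]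
      have h2 : (B.charpoly - (X - C a) ^ 2) * (X - C u) = 0 := by rw [sub_mul, h1, sub_self]
      exact sub_eq_zero.1 (((monic_X_sub_C u).mul_left_eq_zero_iff).1 h2)
    have hN : (B - a • 1) * (B - a • 1) = 0 := by
      have h := Matrix.aeval_self_charpoly B
      rw [hχB, map_pow, map_sub, aeval_X, aeval_C, Algebra.algebraMap_eq_smul_one, pow_two] at h
      exact h
    -- `B` is unitary for the anisotropic `G₁′`
    have hMU : (M.map σ)ᵀ * finSum 2 1 G₁' G₂' * M = finSum 2 1 G₁' G₂' := by
      have hmP : (m.1.val.val : Matrix (Fin 3) (Fin 3) (UnitaryGroup.LocalRing L v)) * P'.val = P'.val * M := by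
        rw [hMdef, ← Matrix.mul_assoc, ← Matrix.mul_assoc, hPinv', Matrix.one_mul]
      have h1 : twistGram σ Hv ((m.1.val.val : Matrix (Fin 3) (Fin 3) (UnitaryGroup.LocalRing L v)) * P'.val) = finSum 2 1 G₁' G₂' := by
        rw [twistGram_unitary_mul σ Hv m.1.2, hP']
      rw [hmP, twistGram_mul, hP'] at h1
      exact h1
    rw [hMBT] at hMU
    have hBU : (B.map σ)ᵀ * G₁' * B = G₁' := block_unitary_fst₁₇ σ hMU
    have hBa : B = a • 1 := eq_smul_one_of_unitary_of_mul_self_eq_zero σ hanis' hBU hσa hN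
    -- so `m = ε′`
    have hMeq : M = D := by rw [hMBT, hBa, hT, hD]
    have hmmat : (m.1.val.val : Matrix (Fin 3) (Fin 3) (UnitaryGroup.LocalRing L v)) = ε'.val.val := by
      have hmP : (m.1.val.val : Matrix (Fin 3) (Fin 3) (UnitaryGroup.LocalRing L v)) * P'.val = P'.val * M := by
        rw [hMdef, ← Matrix.mul_assoc, ← Matrix.mul_assoc, hPinv', Matrix.one_mul]
      rw [hconj' hmP, hconj' hε'D, hMeq]
    exact Subtype.ext (Subtype.ext (Units.ext hmmat))
  -- (3) compactness of `Z(ε′)` and the tube argument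
  intro B' hB'
  have hd' : G₁'.det * G₂' 0 0 = σ P'.val.det * Hv.det * P'.val.det := by
    rw [← Matrix.det_fin_one G₂', ← det_finSum, ← hP', det_twistGram]
  have hG₂'u : IsUnit (G₂' 0 0) := by
    refine isUnit_of_mul_isUnit_right (?_ : IsUnit (G₁'.det * G₂' 0 0))
    rw [hd']
    exact (((Matrix.isUnits_det_units P').map σ).mul hHd).mul (Matrix.isUnits_det_units P')
  haveI : CompactSpace ↥Z := compactSpace_centralizer_of_frame_of_anisotropic L v H' ε' w hw hau hε'D hP' hanis' hG₂'u
  set O := interior B' with hOdef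
  have hO : IsOpen O := isOpen_interior
  have hεO : εC ∈ O := mem_interior_iff_mem_nhds.2 hB'
  have hK : IsCompact Oᶜ := hO.isClosed_compl.isCompact
  have hFK : IsClosed (F '' Oᶜ) := (hK.image hFc).isClosed
  have hnot : F εC ∉ F '' Oᶜ := by
    rintro ⟨m, hm, hFm⟩
    rw [hfib m hFm] at hm
    exact hm hεO
  -- (4) the neighbourhood of `ε_H`
  let Fγ : ((UnitaryGroup.cmDatum L 2 (Matrix.of fun i j : Fin 2 => if i.val + j.val + 1 = 2 then (1 : L) else 0)).Local v ×
      (UnitaryGroup.cmDatum L 1 (Matrix.of fun i j : Fin 1 => if i.val + j.val + 1 = 1 then (1 : L) else 0)).Local v) →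
      (ℕ → UnitaryGroup.LocalRing L v) × UnitaryGroup.LocalRing L v := fun γH =>
    (fun k => (((endoEmbLocal L v γH).val.val : Matrix (Fin 3) (Fin 3) (UnitaryGroup.LocalRing L v))).charpoly.coeff k,
      (γH.2.val.val : Matrix (Fin 1) (Fin 1) (UnitaryGroup.LocalRing L v)) 0 0)
  have hιc : Continuous fun γH : ((UnitaryGroup.cmDatum L 2 (Matrix.of fun i j : Fin 2 => if i.val + j.val + 1 = 2 then (1 : L) else 0)).Local v ×
      (UnitaryGroup.cmDatum L 1 (Matrix.of fun i j : Fin 1 => if i.val + j.val + 1 = 1 then (1 : L) else 0)).Local v) =>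
      (((endoEmbLocal L v γH).val.val : Matrix (Fin 3) (Fin 3) (UnitaryGroup.LocalRing L v))) :=
    (Units.continuous_val.comp continuous_subtype_val).comp (continuous_endoEmbLocal L v)
  have hFγc : Continuous Fγ :=
    (continuous_pi fun k => (continuous_charpoly_coeff k).comp hιc).prodMk
      (((Units.continuous_val.comp continuous_subtype_val).comp continuous_snd).matrix_elem 0 0)
  have hFγε : Fγ εH = F εC := by
    rw [hFε]
    show (fun k => (((endoEmbLocal L v εH).val.val : Matrix (Fin 3) (Fin 3) (UnitaryGroup.LocalRing L v))).charpoly.coeff k,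
      (εH.2.val.val : Matrix (Fin 1) (Fin 1) (UnitaryGroup.LocalRing L v)) 0 0) = _
    rw [hχι]
  refine ⟨Fγ ⁻¹' (F '' Oᶜ)ᶜ, (hFK.isOpen_compl.preimage hFγc).mem_nhds (by rw [Set.mem_preimage, hFγε]; exact hnot), ?_⟩
  -- (5) a framed match of `γ_H ∈ V` lands in `B′`
  rintro γH hγV g ⟨B, hgP⟩ hpair
  have hg : g ∈ Z := hmemZ g B _ hgP
  refine ⟨hg, ?_⟩
  have hFg : F ⟨g, hg⟩ = Fγ γH := by
    obtain ⟨y, hy⟩ := isConj_iff.1 ((isLocalNormPair_iff L H' v γH g).1 hpair)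
    have hgmat : (g.val.val : Matrix (Fin 3) (Fin 3) (UnitaryGroup.LocalRing L v)) =
        y.val * ((endoEmbLocal L v γH).val.val : Matrix (Fin 3) (Fin 3) (UnitaryGroup.LocalRing L v)) * y.val⁻¹ := by
      rw [← Matrix.coe_units_inv, ← Units.val_mul, ← Units.val_mul, hy]
    have hχg : (g.val.val : Matrix (Fin 3) (Fin 3) (UnitaryGroup.LocalRing L v)).charpoly =
        (((endoEmbLocal L v γH).val.val : Matrix (Fin 3) (Fin 3) (UnitaryGroup.LocalRing L v))).charpoly := by
      rw [hgmat, Matrix.charpoly_units_conj]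
    have hgj : ((P'⁻¹).val * (g.val.val : Matrix (Fin 3) (Fin 3) (UnitaryGroup.LocalRing L v)) * P'.val) j j =
        (γH.2.val.val : Matrix (Fin 1) (Fin 1) (UnitaryGroup.LocalRing L v)) 0 0 := by
      rw [hconj hgP, hfinj]
    show ((fun k => (g.val.val : Matrix (Fin 3) (Fin 3) (UnitaryGroup.LocalRing L v)).charpoly.coeff k,
      ((P'⁻¹).val * (g.val.val : Matrix (Fin 3) (Fin 3) (UnitaryGroup.LocalRing L v)) * P'.val) j j) :
        (ℕ → UnitaryGroup.LocalRing L v) × UnitaryGroup.LocalRing L v) = _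
    rw [hχg, hgj]
  have hgO : (⟨g, hg⟩ : ↥Z) ∈ O := by
    by_contra hc
    have hmem : F ⟨g, hg⟩ ∈ F '' Oᶜ := ⟨⟨g, hg⟩, hc, rfl⟩
    rw [hFg] at hmem
    exact hγV hmem
  exact interior_subset hgO

end CM

end Literature.NumberTheory.Rogawski1990
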